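import Summits.BirchSwinnertonDyer.BirchSwinnertonDyer.Theorems.KatoDescentPotSupersingularWildUpperUnitTwistRecordsFlat17
import Summits.BirchSwinnertonDyer.BirchSwinnertonDyer.Theorems.KatoDescentPotSupersingularWildUpperUnitTwistRecordsFlat30
import Summits.BirchSwinnertonDyer.BirchSwinnertonDyer.Theorems.KatoDescentPotSupersingularWildUpperUnitTwistRecordsFlat37
import Summits.BirchSwinnertonDyer.BirchSwinnertonDyer.Theorems.KatoDescentPotSupersingularWildUpperUnitTwistRecordsFlat42
import Summits.BirchSwinnertonDyer.BirchSwinnertonDyer.Theorems.KatoDescentPotSupersingularWildLowerDesc3RecordsX4ns01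
import HarnessLib

/-!
# Route `KatoDescentPotSupersingular` (rung K9, sub-rung B5 = O6 wild `p = 3`, cell `bsd-potss`): `BSD(E,3)` OF THE PAIR for the FOUR
# U₀-ns ♭ unit-twist rows with `#Ш(E)_an = 9` — BOTH halves per row from landed records: the UPPER half (this seat's unit-twist record
# `missingUpperBoundAt_g<label>_3`, ♭ road p598429 over kmc F15) and the LOWER half (k9-desc3's `3`-descent record
# `K9Desc3.lower3_sel_<label>`, `…WildLowerDesc3RecordsX4ns01`): rows 181629r1, 292032gn1, 382347x1, 499392dk1 @ 3
# (seat `bsd-potss-k9-c4` g16; `--supports stmt-BirchSwinnertonDyer-19197 --as helper`)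

HONEST FRAMING. THEOREMS ONLY; PER PAIR; nothing booked here; items 19189 / 19197 / 19663 stay OPEN class-wide; BSD is not proved
for any class.  On these four INTRINSIC wild classes (X4, mod-3 image 3Nn/3Ns, `r_an = 0`, Cremona `#Ш_an = 9`, `∏c_ℓ` prime to 3,
single-member isogeny classes) the two landed per-row records meet: `ord₃ #Ш(E) ≥ 2` (Cassels–Tate + `Sel^(3)(E/ℚ) ≠ ⊥` certificate,
k9-desc3 / k9-c2 kit j250472) and `ord₃ #Ш(E) ≤ ord₃ #Ш(E)_an = 2` (Matar–Nekovář 0.3 at a unit rank-one Heegner twist, this seat's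
kit j297595), so `ord₃ #Ш(E) = ord₃ #Ш(E)_an` and Miller's `BSD(E,3)` follows by `Typed.missingPPartAt_of_lower_of_upper` +
`Typed.bsdp_of_missingPPartAt` — CONDITIONAL on the displayed named facts {Cassels–Tate pairing, GZK, Gross–Zagier, Kolyvagin,
Matar–Nekovář 2019 Thm 0.3, modularity} and the displayed data of both records (`r_an(E) = 0`, `#Ш_an(E) = 9`, the `3`-descent line
`hSel`, Cremona's `N`, `3 ∤ ∏c_ℓ`, a datum `D` with `3 ∤ c(D)`, the twist's `r_an = 1` and unit `#Ш_an`).  These are, to this seat's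
knowledge, the first K9 U₀-ns pairs with NON-trivial `Ш[3]` whose `3`-part of BSD is a kernel theorem modulo print + numerics.

References: [MatarNekovar2019] Thm. 0.3; [GrossZagier1986] I.6.3; [KolyvaginEulerSystems1990] Thm. A; [MilneADT2006] Thm. I.7.3
(Cassels–Tate); [SchaeferStoll2004]; [Miller2011LMS] §1, Def. 1.1; [Darmon2004] Thm. 3.22; [Cremona2006] Tables 1, 4.
-/

set_option autoImplicit false
set_option linter.dupNamespace false
noncomputable section
open scoped Classical NumberField
open WeierstrassCurve NumberField Field
  Literature.NumberTheory.EllipticCurves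
  Literature.NumberTheory.EllipticCurves.ModularForms Literature.NumberTheory.EllipticCurves.Rank1Residual
  Literature.NumberTheory.EllipticCurves.Rank1Residual.Typed Literature.NumberTheory.Automorphic
  Summit.BirchSwinnertonDyer.Rank1Residual Summit.BirchSwinnertonDyer.Rank1Residual.Additive
  Summit.BirchSwinnertonDyer.BirchSwinnertonDyer.Theorems

namespace Summit.BirchSwinnertonDyer.BirchSwinnertonDyer.Theorems.WildUpperUnitTwistRecords

/-- **`BSD(E,3)` (Miller) for the PAIR `E = 181629r1`, `p = 3`, with `#Ш(E)_an = 9`** — O6 wild `3` (`N = 181629`), U₀-ns ♭ row (mod-3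
image Nn), `r_an = 0`, `∏c_ℓ = 2`: LOWER half = `K9Desc3.lower3_sel_181629r1` (Cassels–Tate `hCT` + GZK + the displayed
`3`-descent line `hSel : Sel^(3)(E/ℚ) ≠ ⊥`, kit j250472), UPPER half = `missingUpperBoundAt_g181629r1_3` (MN19 0.3 + GZ + Kolyvagin + GZK +
modularity + the unit rank-one twist `d_K = -83`, kit j297595); together `ord₃ #Ш(E) = ord₃ #Ш(E)_an (= 2)` and GZK closes `BSD(E,3)`.
CONDITIONAL on the displayed hypotheses; per pair; books nothing by itself. [cite: Miller2011LMS, §1 and Def. 1.1]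
[cite: MatarNekovar2019, Thm. 0.3 (p. 456)] [cite: MilneADT2006, Thm. I.7.3] [cite: Cremona2006, Table 4 (Cremona label 181629r1)] -/
theorem bsdp_g181629r1_3_of_sel3
    (hCT : exists_casselsTate_pairing (K := ℚ))
    (hGZ : ∀ (N : ℕ) [NeZero N] (W : WeierstrassCurve ℚ) (K : Type) [Field K] [NumberField K],
      gross_zagier N W K)
    (hKo : ∀ (N : ℕ) [NeZero N] (W : WeierstrassCurve ℚ) (K : Type) [Field K] [NumberField K],
      kolyvagin N W K)
    (hMN : ∀ (N : ℕ) [NeZero N] (W : WeierstrassCurve ℚ) (K : Type) [Field K] [NumberField K],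
      MatarNekovar2019.thm03_padicValNat_card_sha_le_of_irreducible N W K)
    (hGZK : rank_eq_analyticRank_of_analyticRank_le_one) (hmod : hasEntireLFunction_rat)
    {W : WeierstrassCurve ℚ} [W.IsElliptic] [W.IsGloballyMinimal] (hWeq : W = (⟨0, 0, 1, 89373, 21471863⟩ : WeierstrassCurve ℚ))
    (hN : W.conductorNorm ℤ = 181629) (hr : W.analyticRank = 0) (htam : ¬ 3 ∣ W.tamagawaProduct)
    (D : ModularParametrizationData W 181629) (hc : ¬ (3 : ℤ) ∣ D.c)
    (K : Type) [Field K] [NumberField K] (hK : IsImaginaryQuadratic K) (hdK : NumberField.discr K = -83)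
    {Wd : WeierstrassCurve ℚ} [Wd.IsElliptic] [Wd.IsGloballyMinimal] (hWdeq : Wd = (⟨0, 0, 1, 615690597, (-12277332272128)⟩ : WeierstrassCurve ℚ))
    (hrd : Wd.analyticRank = 1) {qd : ℚ} (hqd : shaAn Wd = (qd : ℂ)) (hvd : padicValRat 3 qd ≤ 0)
    {s : ℚ} (hs : shaAn W = (s : ℂ)) (hv : padicValRat 3 s ≤ 2) (hSel : W.selmerGroup (3 : ℤ) ≠ ⊥) :
    BSDp W 3 :=
  bsdp_of_missingPPartAt W 3 hGZK (by rw [hr]; exact zero_le_one)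
    (missingPPartAt_of_lower_of_upper W 3 (K9Desc3.lower3_sel_181629r1 hCT hGZK W hWeq hr hs hv hSel)
      (missingUpperBoundAt_g181629r1_3 hGZ hKo hMN hGZK hmod hWeq hN hr htam D hc K hK hdK hWdeq hrd hqd hvd))

/-- **`BSD(E,3)` (Miller) for the PAIR `E = 292032gn1`, `p = 3`, with `#Ш(E)_an = 9`** — O6 wild `3` (`N = 292032`), U₀-ns ♭ row (mod-3
image Nn), `r_an = 0`, `∏c_ℓ = 1`: LOWER half = `K9Desc3.lower3_sel_292032gn1` (Cassels–Tate `hCT` + GZK + the displayed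
`3`-descent line `hSel : Sel^(3)(E/ℚ) ≠ ⊥`, kit j250472), UPPER half = `missingUpperBoundAt_g292032gn1_3` (MN19 0.3 + GZ + Kolyvagin + GZK +
modularity + the unit rank-one twist `d_K = -23`, kit j297595); together `ord₃ #Ш(E) = ord₃ #Ш(E)_an (= 2)` and GZK closes `BSD(E,3)`.
CONDITIONAL on the displayed hypotheses; per pair; books nothing by itself. [cite: Miller2011LMS, §1 and Def. 1.1]
[cite: MatarNekovar2019, Thm. 0.3 (p. 456)] [cite: MilneADT2006, Thm. I.7.3] [cite: Cremona2006, Table 4 (Cremona label 292032gn1)] -/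
theorem bsdp_g292032gn1_3_of_sel3
    (hCT : exists_casselsTate_pairing (K := ℚ))
    (hGZ : ∀ (N : ℕ) [NeZero N] (W : WeierstrassCurve ℚ) (K : Type) [Field K] [NumberField K],
      gross_zagier N W K)
    (hKo : ∀ (N : ℕ) [NeZero N] (W : WeierstrassCurve ℚ) (K : Type) [Field K] [NumberField K],
      kolyvagin N W K)
    (hMN : ∀ (N : ℕ) [NeZero N] (W : WeierstrassCurve ℚ) (K : Type) [Field K] [NumberField K],
      MatarNekovar2019.thm03_padicValNat_card_sha_le_of_irreducible N W K)
    (hGZK : rank_eq_analyticRank_of_analyticRank_le_one) (hmod : hasEntireLFunction_rat)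
    {W : WeierstrassCurve ℚ} [W.IsElliptic] [W.IsGloballyMinimal] (hWeq : W = (⟨0, 0, 0, (-1014), (-13182)⟩ : WeierstrassCurve ℚ))
    (hN : W.conductorNorm ℤ = 292032) (hr : W.analyticRank = 0) (htam : ¬ 3 ∣ W.tamagawaProduct)
    (D : ModularParametrizationData W 292032) (hc : ¬ (3 : ℤ) ∣ D.c)
    (K : Type) [Field K] [NumberField K] (hK : IsImaginaryQuadratic K) (hdK : NumberField.discr K = -23)
    {Wd : WeierstrassCurve ℚ} [Wd.IsElliptic] [Wd.IsGloballyMinimal] (hWdeq : Wd = (⟨0, 0, 0, (-536406), 160385394⟩ : WeierstrassCurve ℚ))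
    (hrd : Wd.analyticRank = 1) {qd : ℚ} (hqd : shaAn Wd = (qd : ℂ)) (hvd : padicValRat 3 qd ≤ 0)
    {s : ℚ} (hs : shaAn W = (s : ℂ)) (hv : padicValRat 3 s ≤ 2) (hSel : W.selmerGroup (3 : ℤ) ≠ ⊥) :
    BSDp W 3 :=
  bsdp_of_missingPPartAt W 3 hGZK (by rw [hr]; exact zero_le_one)
    (missingPPartAt_of_lower_of_upper W 3 (K9Desc3.lower3_sel_292032gn1 hCT hGZK W hWeq hr hs hv hSel)
      (missingUpperBoundAt_g292032gn1_3 hGZ hKo hMN hGZK hmod hWeq hN hr htam D hc K hK hdK hWdeq hrd hqd hvd))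

/-- **`BSD(E,3)` (Miller) for the PAIR `E = 382347x1`, `p = 3`, with `#Ш(E)_an = 9`** — O6 wild `3` (`N = 382347`), U₀-ns ♭ row (mod-3
image Nn), `r_an = 0`, `∏c_ℓ = 4`: LOWER half = `K9Desc3.lower3_sel_382347x1` (Cassels–Tate `hCT` + GZK + the displayed
`3`-descent line `hSel : Sel^(3)(E/ℚ) ≠ ⊥`, kit j250472), UPPER half = `missingUpperBoundAt_g382347x1_3` (MN19 0.3 + GZ + Kolyvagin + GZK +
modularity + the unit rank-one twist `d_K = -47`, kit j297595); together `ord₃ #Ш(E) = ord₃ #Ш(E)_an (= 2)` and GZK closes `BSD(E,3)`.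
CONDITIONAL on the displayed hypotheses; per pair; books nothing by itself. [cite: Miller2011LMS, §1 and Def. 1.1]
[cite: MatarNekovar2019, Thm. 0.3 (p. 456)] [cite: MilneADT2006, Thm. I.7.3] [cite: Cremona2006, Table 4 (Cremona label 382347x1)] -/
theorem bsdp_g382347x1_3_of_sel3
    (hCT : exists_casselsTate_pairing (K := ℚ))
    (hGZ : ∀ (N : ℕ) [NeZero N] (W : WeierstrassCurve ℚ) (K : Type) [Field K] [NumberField K],
      gross_zagier N W K)
    (hKo : ∀ (N : ℕ) [NeZero N] (W : WeierstrassCurve ℚ) (K : Type) [Field K] [NumberField K],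
      kolyvagin N W K)
    (hMN : ∀ (N : ℕ) [NeZero N] (W : WeierstrassCurve ℚ) (K : Type) [Field K] [NumberField K],
      MatarNekovar2019.thm03_padicValNat_card_sha_le_of_irreducible N W K)
    (hGZK : rank_eq_analyticRank_of_analyticRank_le_one) (hmod : hasEntireLFunction_rat)
    {W : WeierstrassCurve ℚ} [W.IsElliptic] [W.IsGloballyMinimal] (hWeq : W = (⟨1, (-1), 1, (-52320470), (-145653064406)⟩ : WeierstrassCurve ℚ))
    (hN : W.conductorNorm ℤ = 382347) (hr : W.analyticRank = 0) (htam : ¬ 3 ∣ W.tamagawaProduct)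
    (D : ModularParametrizationData W 382347) (hc : ¬ (3 : ℤ) ∣ D.c)
    (K : Type) [Field K] [NumberField K] (hK : IsImaginaryQuadratic K) (hdK : NumberField.discr K = -47)
    {Wd : WeierstrassCurve ℚ} [Wd.IsElliptic] [Wd.IsGloballyMinimal] (hWdeq : Wd = (⟨1, (-1), 1, (-115575917540), 15123525016807036⟩ : WeierstrassCurve ℚ))
    (hrd : Wd.analyticRank = 1) {qd : ℚ} (hqd : shaAn Wd = (qd : ℂ)) (hvd : padicValRat 3 qd ≤ 0)
    {s : ℚ} (hs : shaAn W = (s : ℂ)) (hv : padicValRat 3 s ≤ 2) (hSel : W.selmerGroup (3 : ℤ) ≠ ⊥) :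
    BSDp W 3 :=
  bsdp_of_missingPPartAt W 3 hGZK (by rw [hr]; exact zero_le_one)
    (missingPPartAt_of_lower_of_upper W 3 (K9Desc3.lower3_sel_382347x1 hCT hGZK W hWeq hr hs hv hSel)
      (missingUpperBoundAt_g382347x1_3 hGZ hKo hMN hGZK hmod hWeq hN hr htam D hc K hK hdK hWdeq hrd hqd hvd))

/-- **`BSD(E,3)` (Miller) for the PAIR `E = 499392dk1`, `p = 3`, with `#Ш(E)_an = 9`** — O6 wild `3` (`N = 499392`), U₀-ns ♭ row (mod-3
image Nn), `r_an = 0`, `∏c_ℓ = 2`: LOWER half = `K9Desc3.lower3_sel_499392dk1` (Cassels–Tate `hCT` + GZK + the displayed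
`3`-descent line `hSel : Sel^(3)(E/ℚ) ≠ ⊥`, kit j250472), UPPER half = `missingUpperBoundAt_g499392dk1_3` (MN19 0.3 + GZ + Kolyvagin + GZK +
modularity + the unit rank-one twist `d_K = -47`, kit j297595); together `ord₃ #Ш(E) = ord₃ #Ш(E)_an (= 2)` and GZK closes `BSD(E,3)`.
CONDITIONAL on the displayed hypotheses; per pair; books nothing by itself. [cite: Miller2011LMS, §1 and Def. 1.1]
[cite: MatarNekovar2019, Thm. 0.3 (p. 456)] [cite: MilneADT2006, Thm. I.7.3] [cite: Cremona2006, Table 4 (Cremona label 499392dk1)] -/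
theorem bsdp_g499392dk1_3_of_sel3
    (hCT : exists_casselsTate_pairing (K := ℚ))
    (hGZ : ∀ (N : ℕ) [NeZero N] (W : WeierstrassCurve ℚ) (K : Type) [Field K] [NumberField K],
      gross_zagier N W K)
    (hKo : ∀ (N : ℕ) [NeZero N] (W : WeierstrassCurve ℚ) (K : Type) [Field K] [NumberField K],
      kolyvagin N W K)
    (hMN : ∀ (N : ℕ) [NeZero N] (W : WeierstrassCurve ℚ) (K : Type) [Field K] [NumberField K],
      MatarNekovar2019.thm03_padicValNat_card_sha_le_of_irreducible N W K)
    (hGZK : rank_eq_analyticRank_of_analyticRank_le_one) (hmod : hasEntireLFunction_rat)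
    {W : WeierstrassCurve ℚ} [W.IsElliptic] [W.IsGloballyMinimal] (hWeq : W = (⟨0, 0, 0, (-15606), (-795906)⟩ : WeierstrassCurve ℚ))
    (hN : W.conductorNorm ℤ = 499392) (hr : W.analyticRank = 0) (htam : ¬ 3 ∣ W.tamagawaProduct)
    (D : ModularParametrizationData W 499392) (hc : ¬ (3 : ℤ) ∣ D.c)
    (K : Type) [Field K] [NumberField K] (hK : IsImaginaryQuadratic K) (hdK : NumberField.discr K = -47)
    {Wd : WeierstrassCurve ℚ} [Wd.IsElliptic] [Wd.IsGloballyMinimal] (hWdeq : Wd = (⟨0, 0, 0, (-34473654), 82633348638⟩ : WeierstrassCurve ℚ))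
    (hrd : Wd.analyticRank = 1) {qd : ℚ} (hqd : shaAn Wd = (qd : ℂ)) (hvd : padicValRat 3 qd ≤ 0)
    {s : ℚ} (hs : shaAn W = (s : ℂ)) (hv : padicValRat 3 s ≤ 2) (hSel : W.selmerGroup (3 : ℤ) ≠ ⊥) :
    BSDp W 3 :=
  bsdp_of_missingPPartAt W 3 hGZK (by rw [hr]; exact zero_le_one)
    (missingPPartAt_of_lower_of_upper W 3 (K9Desc3.lower3_sel_499392dk1 hCT hGZK W hWeq hr hs hv hSel)
      (missingUpperBoundAt_g499392dk1_3 hGZ hKo hMN hGZK hmod hWeq hN hr htam D hc K hK hdK hWdeq hrd hqd hvd))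

end Summit.BirchSwinnertonDyer.BirchSwinnertonDyer.Theorems.WildUpperUnitTwistRecords

end
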